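import Summits.CriticalPhenomena.SAWScalingLimit.Theorems.SAWLoopFugacityFlowSimpleSubseqLimitsStubDomainMarkovCells
import Summits.CriticalPhenomena.SAWScalingLimit.Theorems.SAWLoopFugacityFlowSimpleSubseqLimitsStubDomainMarkovWalks
import HarnessLib

/-!
# STUB 3c — the exact domain Markov property of the critical SAW on cell domains
(`stub_sawDomainMarkov` of the line `capacity-clock-no-plateau`, crux
`SAWLoopFugacityFlow.SimpleSubseqLimits`, stmt-CriticalPhenomena-4982; registered skeleton
`Summits/CriticalPhenomena/SAWScalingLimit/Cruxes/SimpleSubseqLimits/CapacityClockNoPlateau`)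

`SAWDomainMarkov` (VERBATIM the registered skeleton's statement; `cellDomain`, `remainingVerts`
are the verbatim copies of `…StubDomainMarkovCells.lean`, same namespace): for a vertex set `S`
connected in `ℤ²`, a mesh `δ > 0`, a prefix `p = [p₀, …, p_K]` with last vertex `t` and a
Borel set `B` of curve classes, the critical SAW law `P(γ) ∝ x_c^{|γ|}` of the cell domain
`U(S, δ)` from `a` to `b` satisfies
`P{prefix = p, [remaining polyline] ∈ B} = P{prefix = p} · (P^{U(S'', δ)}_{t → b} ∘ curve⁻¹)(B)`,
`S'' = remainingVerts S {p₀..p_{K-1}} t` (Madras–Slade 1993, §1.2; Lawler–Schramm–Werner 2004,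
§3.4; Kemppainen–Smirnov 2017, §4.1.6: "at time `t` the domain `U_t` is admissible").

Proof (`law_prefix_eq`). By `cellGraph_adj_iff` / `remGraph_adj_iff` both discretisations are
induced subgraphs of `ℤ²`, the remaining one a subgraph of the original (`remGraph_le`). If no
SAW has prefix `p`, both sides vanish. Otherwise the prefix of such a SAW is a path
`pw : a → t` with support `p` (`prefixWalk`), and gluing (`glue`, support file
`…StubDomainMarkovWalks.lean`) is a bijection from the SAWs of `U(S'', δ)` from `t` to `b` onto
the prefix event: tails of remaining SAWs avoid `p` (`not_mem_prefix_of_mem_tail`: a vertex after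
the tip is a remaining vertex, hence not in `{p₀..p_{K-1}}`, and is not `t`), and the remaining
edges of a SAW with prefix `p` are edges of `U(S'', δ)_δ` (`drop_edges_mem`: by self-avoidance
the remaining vertices avoid `{p₀..p_{K-1}}` and are joined to `t` along the walk inside `S`).
Lengths add, so the weights factor as `x_c^K · x_c^{|η|}` (`x_c ≥ 0`), whence
`W_S(prefix = p, polyline ∈ B) = x_c^K · W_{S''}(polyline ∈ B)` (`weight_prefix_inter`, a
reindexed `tsum`); the identity follows by `ℝ≥0∞` algebra, the cases `Z_{S''} ∈ {0, ∞}` making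
both sides `0`. No named facts; no positivity of `x_c` is used.
-/

noncomputable section

open MeasureTheory Filter Topology Set
open Literature.Probability.RandomPlanarGeometry Literature.Probability.LatticeModels
open scoped ENNReal NNReal unitInterval

namespace Summit.CriticalPhenomena.SAWScalingLimit.Theorems.SimpleSubseqLimits.CapacityClock.DomainMarkov

/-- **Exact domain Markov property of the critical SAW law on cell domains** (the configurational
`x_c`-weights factorise: Madras–Slade §1.2; LSW04 §3.4.5; KS §4.1.6 "at time `t` the domain `U_t`
is admissible"): for a connected vertex set `S`, a prefix `p = [p₀, …, p_k]` with last vertex `t`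
and a Borel set `B` of curve classes, the law of the SAW of `U(S, δ)` from `a` to `b` restricted
to {prefix = `p`, class of the REMAINING polyline ∈ `B`} factorises as P{prefix = `p`} times the
pushed-forward SAW law of the remaining cell domain `U(S'', δ)` from `t` to `b`, where
`S'' = remainingVerts S {p₀,…,p_{k-1}} t`. Degenerate data (invalid prefix, `a ∉ S`, no walk)
make both sides `0`. VERBATIM copy of the registered skeleton's `SAWDomainMarkov`; a route-local
statement PROVED below (`stub_sawDomainMarkov`), deliberately untagged (not a vendored fact). -/
def SAWDomainMarkov : Prop :=
  ∀ (S : Finset (Site 2)) (δ : ℝ) (a b : Site 2) (p : List (Site 2)) (t : Site 2), 0 < δ →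
    ((zdGraph 2).induce (↑S : Set (Site 2))).Preconnected → p ≠ [] → p.getLast? = some t →
    ∀ B : Set (CurveClass ℂ), MeasurableSet B →
      SAW.law (cellDomain S δ) δ a b
          {γ | γ.walk.support.take p.length = p ∧
            CurveClass.mk ⟨(γ.walk.drop (p.length - 1)).toCurve (meshPoint δ)⟩ ∈ B} =
        SAW.law (cellDomain S δ) δ a b {γ | γ.walk.support.take p.length = p} *
          (SAW.law (cellDomain (remainingVerts S (p.dropLast).toFinset t) δ) δ t b).map
            (fun γ => γ.curve) B

variable {S : Finset (Site 2)} {δ : ℝ}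

/-! ### The prefix event on a cell domain -/

section Markov

variable {a b t : Site 2} {p : List (Site 2)} {K : ℕ}

/-- **Tails of SAWs of the remaining domain avoid the prefix**: a vertex after the tip on a SAW
of `U(remainingVerts S {p₀..p_{K-1}} t, δ)` from `t` is a remaining vertex (hence not among
`p₀..p_{K-1}`) and is not `t`. [folklore] -/
theorem not_mem_prefix_of_mem_tail (hδ : 0 < δ) (hpt : p.getLast? = some t)
    (η : SAW.DomainSAW (cellDomain (remainingVerts S p.dropLast.toFinset t) δ) δ t b)
    {x : Site 2} (hx : x ∈ η.walk.support.tail) : x ∉ p := by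
  obtain ⟨ys, rfl⟩ := List.getLast?_eq_some_iff.1 hpt
  have hnd := (SimpleGraph.Walk.isPath_def _).1 η.isPath
  rw [← SimpleGraph.Walk.cons_tail_support, List.nodup_cons] at hnd
  obtain ⟨y, hy⟩ := exists_adj_of_mem_support_tail η.walk hx
  have hxP := (mem_and_not_mem_of_mem_remainingVerts ((remGraph_adj_iff hδ).1 hy).2.2).2
  rw [List.dropLast_concat, List.mem_toFinset] at hxP
  intro hxp
  rw [List.mem_append, List.mem_singleton] at hxp
  rcases hxp with h | rfl
  · exact hxP h
  · exact hnd.1 hx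

/-- **The remaining walk lives in the remaining domain**: for a SAW `γ` of `U(S, δ)` with prefix
`p`, every edge of `γ` after time `K` is an edge of `U(remainingVerts S {p₀..p_{K-1}} t, δ)_δ`.
[folklore] -/
theorem drop_edges_mem (hδ : 0 < δ) (hS : ((zdGraph 2).induce (↑S : Set (Site 2))).Preconnected)
    (hpK : p.length = K + 1) (hpt : p.getLast? = some t)
    (γ : SAW.DomainSAW (cellDomain S δ) δ a b) (hγ : γ.walk.support.take (K + 1) = p) :
    ∀ e ∈ (γ.walk.drop K).edges, e ∈
      (discreteDomainGraph (cellDomain (remainingVerts S p.dropLast.toFinset t) δ) δ).edgeSet := by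
  classical
  obtain ⟨hlen, hK⟩ := getVert_eq_of_take_eq γ.walk hpK hpt hγ
  have hsupp : (γ.walk.drop K).support = γ.walk.support.drop K := by
    rw [SimpleGraph.Walk.drop_support_eq_support_drop_min, Nat.min_eq_left hlen]
  -- the remaining vertices avoid the deleted prefix `p₀..p_{K-1}` (self-avoidance of `γ`)
  have hdis : ∀ v ∈ γ.walk.support.drop K, v ∉ p.dropLast := by
    intro v hv hv'
    have hnd := (SimpleGraph.Walk.isPath_def _).1 γ.isPath
    rw [← List.take_append_drop K γ.walk.support, List.nodup_append] at hnd
    have : p.dropLast = γ.walk.support.take K := by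
      rw [List.dropLast_eq_take, hpK, Nat.add_sub_cancel, ← hγ, List.take_take,
        Nat.min_eq_left (Nat.le_succ K)]
    rw [this] at hv'
    exact hnd.2.2 v hv' v hv rfl
  -- a remaining vertex lying in `S` is joined to `t` inside `S ∖ {p₀..p_{K-1}}`
  have hmem : ∀ x ∈ (γ.walk.drop K).support, x ∈ S →
      x ∈ remainingVerts S p.dropLast.toFinset t := by
    intro x hx hxS
    have hx' : x ∈ ((γ.walk.drop K).copy hK rfl).support := by
      rw [SimpleGraph.Walk.support_copy]; exact hx
    refine mem_remainingVerts_of_walk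
      ((((γ.walk.drop K).copy hK rfl).takeUntil x hx').mapLe
        ((discreteDomainGraph_le_meshGraph _ _).trans (meshGraph_le_zdGraph _ _)))
      fun v hv => ?_
    rw [SimpleGraph.Walk.support_mapLe_eq_support] at hv
    refine ⟨support_subset_of_adj_closed (T := (↑S : Set (Site 2)))
      (fun x y h => ((cellGraph_adj_iff hδ hS).1 h).2.1) _ hxS v hv, ?_⟩
    rw [List.mem_toFinset]
    refine hdis v ?_
    rw [← hsupp, ← SimpleGraph.Walk.support_copy _ hK rfl]
    exact SimpleGraph.Walk.support_takeUntil_subset_support _ _ hv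
  intro e he
  induction e using Sym2.ind with
  | h x y =>
    obtain ⟨hzd, hxS, hyS⟩ := (cellGraph_adj_iff hδ hS).1 ((γ.walk.drop K).adj_of_mem_edges he)
    rw [SimpleGraph.mem_edgeSet, remGraph_adj_iff hδ]
    exact ⟨hzd, hmem x ((γ.walk.drop K).fst_mem_support_of_mem_edges he) hxS,
      hmem y ((γ.walk.drop K).snd_mem_support_of_mem_edges he) hyS⟩

/-! ### The identity -/

/-- **Factorisation of the critical weights over the prefix event.** If some SAW of `U(S, δ)`
from `a` to `b` has prefix `p`, then for every set `B` of curve classes the weight of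
{prefix `= p`, remaining polyline `∈ B`} is `x_c^K` times the weight of {polyline `∈ B`} for the
SAWs of the remaining domain from the tip `t` to `b` (gluing is a weight-respecting bijection).
[folklore] -/
theorem weight_prefix_inter (hδ : 0 < δ)
    (hS : ((zdGraph 2).induce (↑S : Set (Site 2))).Preconnected)
    (hpK : p.length = K + 1) (hpt : p.getLast? = some t)
    (γ₀ : SAW.DomainSAW (cellDomain S δ) δ a b) (hγ₀ : γ₀.walk.support.take (K + 1) = p)
    (B : Set (CurveClass ℂ)) :
    SAW.weight (cellDomain S δ) δ a b
        {γ | γ.walk.support.take (K + 1) = p ∧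
          CurveClass.mk ⟨(γ.walk.drop K).toCurve (meshPoint δ)⟩ ∈ B} =
      ENNReal.ofReal (SAW.criticalFugacity ^ K) *
        SAW.weight (cellDomain (remainingVerts S p.dropLast.toFinset t) δ) δ t b
          {η | η.curve ∈ B} := by
  set pw := prefixWalk γ₀ hpK hpt hγ₀
  have hsupp : pw.support = p := support_prefixWalk γ₀ hpK hpt hγ₀
  have hlenK : pw.length = K := length_prefixWalk γ₀ hpK hpt hγ₀
  have hpw : pw.IsPath := isPath_prefixWalk γ₀ hpK hpt hγ₀
  have hle := remGraph_le (P := p.dropLast.toFinset) (t := t) hδ hS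
  have hav : ∀ η : SAW.DomainSAW (cellDomain (remainingVerts S p.dropLast.toFinset t) δ) δ t b,
      ∀ x ∈ η.walk.support.tail, x ∉ pw.support := by
    intro η x hx
    rw [hsupp]
    exact not_mem_prefix_of_mem_tail hδ hpt η hx
  rw [weight_apply_tsum, weight_apply_tsum, ← ENNReal.tsum_mul_left]
  refine (((glue_injective pw hpw hle hav).tsum_eq ?_).symm.trans (tsum_congr fun η => ?_))
  · intro γ hγ
    have hγ' := Set.support_indicator_subset hγ
    exact exists_glue_eq pw hpw hle hav hlenK γ (by rw [hsupp]; exact hγ'.1)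
      (drop_edges_mem hδ hS hpK hpt γ hγ'.1)
  · by_cases hB : η.curve ∈ B
    · have hmem : glue pw hpw hle hav η ∈ {γ : SAW.DomainSAW (cellDomain S δ) δ a b |
          γ.walk.support.take (K + 1) = p ∧
            CurveClass.mk ⟨(γ.walk.drop K).toCurve (meshPoint δ)⟩ ∈ B} := by
        refine ⟨?_, ?_⟩
        · rw [take_support_glue pw hpw hle hav hlenK, hsupp]
        · rw [curve_drop_glue pw hpw hle hav hlenK]; exact hB
      have hmem' : η ∈ {η : SAW.DomainSAW (cellDomain (remainingVerts S p.dropLast.toFinset t) δ)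
          δ t b | η.curve ∈ B} := hB
      -- `x_c = μ⁻¹ ≥ 0`: `μ = infₙ c_{n+1}^{1/(n+1)}` is an infimum of nonnegative reals
      have hxc : 0 ≤ SAW.criticalFugacity :=
        inv_nonneg.2 (Real.iInf_nonneg fun _ => Real.rpow_nonneg (Nat.cast_nonneg _) _)
      rw [Set.indicator_of_mem hmem, Set.indicator_of_mem hmem', length_glue, hlenK, pow_add,
        ENNReal.ofReal_mul (pow_nonneg hxc _)]
    · have hmem : glue pw hpw hle hav η ∉ {γ : SAW.DomainSAW (cellDomain S δ) δ a b |
          γ.walk.support.take (K + 1) = p ∧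
            CurveClass.mk ⟨(γ.walk.drop K).toCurve (meshPoint δ)⟩ ∈ B} := by
        intro h
        rw [Set.mem_setOf_eq, curve_drop_glue pw hpw hle hav hlenK] at h
        exact hB h.2
      have hmem' : η ∉ {η : SAW.DomainSAW (cellDomain (remainingVerts S p.dropLast.toFinset t) δ)
          δ t b | η.curve ∈ B} := hB
      rw [Set.indicator_of_notMem hmem, Set.indicator_of_notMem hmem', mul_zero]

/-- **The domain Markov identity at a fixed prefix length** (`p.length = K + 1`). [folklore] -/
theorem law_prefix_eq (hδ : 0 < δ)
    (hS : ((zdGraph 2).induce (↑S : Set (Site 2))).Preconnected)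
    (hpK : p.length = K + 1) (hpt : p.getLast? = some t)
    (B : Set (CurveClass ℂ)) (hB : MeasurableSet B) :
    SAW.law (cellDomain S δ) δ a b
        {γ | γ.walk.support.take (K + 1) = p ∧
          CurveClass.mk ⟨(γ.walk.drop K).toCurve (meshPoint δ)⟩ ∈ B} =
      SAW.law (cellDomain S δ) δ a b {γ | γ.walk.support.take (K + 1) = p} *
        (SAW.law (cellDomain (remainingVerts S p.dropLast.toFinset t) δ) δ t b).map
          (fun γ => γ.curve) B := by
  rw [Measure.map_apply (SAW.DomainSAW.measurable_of_top _) hB]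
  simp only [SAW.law, Measure.smul_apply, smul_eq_mul]
  by_cases hE : ∃ γ₀ : SAW.DomainSAW (cellDomain S δ) δ a b, γ₀.walk.support.take (K + 1) = p
  · obtain ⟨γ₀, hγ₀⟩ := hE
    have h1 := weight_prefix_inter hδ hS hpK hpt γ₀ hγ₀ B
    have h2 := weight_prefix_inter hδ hS hpK hpt γ₀ hγ₀ univ
    have e1 : {γ : SAW.DomainSAW (cellDomain S δ) δ a b | γ.walk.support.take (K + 1) = p ∧
        CurveClass.mk ⟨(γ.walk.drop K).toCurve (meshPoint δ)⟩ ∈ (univ : Set (CurveClass ℂ))} =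
        {γ | γ.walk.support.take (K + 1) = p} := by
      ext γ; simp
    have e2 : {η : SAW.DomainSAW (cellDomain (remainingVerts S p.dropLast.toFinset t) δ) δ t b |
        η.curve ∈ (univ : Set (CurveClass ℂ))} = univ := by
      ext η; simp
    rw [e1, e2] at h2
    rw [h1, h2]
    -- notation
    set c := ENNReal.ofReal (SAW.criticalFugacity ^ K)
    set ZS := SAW.weight (cellDomain S δ) δ a b univ
    set ZR := SAW.weight (cellDomain (remainingVerts S p.dropLast.toFinset t) δ) δ t b univ
    set W := SAW.weight (cellDomain (remainingVerts S p.dropLast.toFinset t) δ) δ t b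
      ((fun γ => γ.curve) ⁻¹' B)
    change ZS⁻¹ * (c * W) = ZS⁻¹ * (c * ZR) * (ZR⁻¹ * W)
    have hWZ : W ≤ ZR := measure_mono (subset_univ _)
    rcases eq_or_ne ZR 0 with h0 | h0
    · have hW : W = 0 := le_antisymm (h0 ▸ hWZ) zero_le
      simp [hW, h0]
    rcases eq_or_ne ZR ⊤ with htop | htop
    · by_cases hc : c = 0
      · simp [hc]
      · have hZS : ZS = ⊤ := by
          refine top_unique ?_
          calc (⊤ : ℝ≥0∞) = c * ZR := by rw [htop, ENNReal.mul_top hc]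
            _ = SAW.weight (cellDomain S δ) δ a b {γ | γ.walk.support.take (K + 1) = p} := h2.symm
            _ ≤ ZS := measure_mono (subset_univ _)
        simp [hZS]
    · calc ZS⁻¹ * (c * W) = ZS⁻¹ * (c * W) * (ZR * ZR⁻¹) := by
            rw [ENNReal.mul_inv_cancel h0 htop, mul_one]
        _ = ZS⁻¹ * (c * ZR) * (ZR⁻¹ * W) := by ring
  · have hE1 :
        {γ : SAW.DomainSAW (cellDomain S δ) δ a b | γ.walk.support.take (K + 1) = p} = ∅ := by
      ext γ
      simp only [mem_setOf_eq, mem_empty_iff_false, iff_false]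
      exact fun h => hE ⟨γ, h⟩
    have hE2 : {γ : SAW.DomainSAW (cellDomain S δ) δ a b | γ.walk.support.take (K + 1) = p ∧
        CurveClass.mk ⟨(γ.walk.drop K).toCurve (meshPoint δ)⟩ ∈ B} = ∅ := by
      ext γ
      simp only [mem_setOf_eq, mem_empty_iff_false, iff_false, not_and]
      exact fun h _ => hE ⟨γ, h⟩
    rw [hE1, hE2, measure_empty, mul_zero, zero_mul]

end Markov

/-- **STUB 3c of the line `capacity-clock-no-plateau` — the exact domain Markov property of the
critical SAW law on cell domains** (`SAWDomainMarkov`, verbatim the registered skeleton's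
statement), from `law_prefix_eq` at `K = p.length - 1`. [folklore] -/
theorem stub_sawDomainMarkov : SAWDomainMarkov := by
  intro S δ a b p t hδ hS hp hpt B hB
  obtain ⟨K, hK⟩ : ∃ K, p.length = K + 1 :=
    ⟨p.length - 1, (Nat.succ_pred_eq_of_pos (List.length_pos_iff.2 hp)).symm⟩
  rw [hK, Nat.add_sub_cancel]
  exact law_prefix_eq hδ hS hK hpt B hB

end Summit.CriticalPhenomena.SAWScalingLimit.Theorems.SimpleSubseqLimits.CapacityClock.DomainMarkov
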